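import Summits.QuantumFields.YangMills.Theorems.SwapVirialDeficitLaplaceAbelian
import Summits.QuantumFields.YangMills.Theorems.SwapVirialDeficitZeroModeSigmaFourSmallBallLimit
import HarnessLib

/-!
# Abelian side of the small-ball ↔ Laplace dictionary, II: two-term core and the LIMIT form
# (free-hands support of ⟨stmt-QuantumFields-24197⟩; companion of ✓`Abelian.laplace_abelian_rate`)

* §4 ★★ `laplace_abelian_two_terms` — if `|μ{G ≤ s} − v·s^α| ≤ K₁·s^{α+θ₁} + K₂·s^{α+θ₂}` for ALL `s > 0` (`θᵢ ≥ 0`), then for every `β > 0`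
  `|β^α·∫e^{−βG}dμ − v·Γ(α+1)| ≤ K₁Γ(α+θ₁+1)β^{−θ₁} + K₂Γ(α+θ₂+1)β^{−θ₂}`;
* §5 ★★★ `tendsto_laplace_abelian` — the LIMIT form: if `μ{G ≤ s}/s^α → v` as `s → 0⁺` then `β^α·∫e^{−βG}dμ → v·Γ(α+1)` as `β → ∞`
  (no rate needed; the far part `s > δ` is absorbed by `s^{α+1}`): the Abelian image of LEAD g93's small-ball LIMIT shapes
  (✓`exists_smallBall_three_limit_unconditional`, w3 g63's σ-twisted four-leader limit) in Laplace currency;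
* §6 ★★★ `tendsto_laplace_sigmaTwisted` — instantiation on w3 g63's ✓`ZeroModeSigma.sigmaBall_smallBall_limit` (`Haar⁴(E_σ(t))/t⁷ → v₇`):
  `β^{7/2}·∫_{SU(2)⁴} e^{−β·(max of the six relation norms)²} dHaar⁴ → v₇·Γ(9/2)` — LEAD g93's second shape in Laplace form (limit; the rate
  follows by ✓`laplace_abelian_rate` the day a small-ball rate for `E_σ` lands).
HONEST LABEL: pure real analysis / measure theory (plan-level glue); NOT the fixed-`L` sharp law, NOT ⟨24197⟩; the Yang–Mills mass gap is NOT proved;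
no summit is proved by a line.  Width seat ym-line-sfw-p2-w2 g56 (cell ym-idea-1, free hands; own crux ⟨22884⟩ blocked-on ⟨19935⟩),
`--supports stmt-QuantumFields-24197`.  THEOREMS ONLY, standard axioms, 0 `sorry`.  References: [folklore] (Feller XIII.5; Bingham–Goldie–Teugels §1.7).
-/

set_option autoImplicit false

noncomputable section

open MeasureTheory Set Real Filter
open scoped ENNReal Topology
open Summit.QuantumFields.YangMills.Theorems.VirialFluxGap.ChebyshevGamma (integral_rpow_mul_exp_neg_mul_Ioi' integrableOn_rpow_mul_exp_neg_mul)

namespace Summit.QuantumFields.YangMills.Theorems.SwapVirialDeficit.Abelian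

variable {Ω : Type*} [MeasurableSpace Ω]

/-! ## §4 The two-term core -/

/-- A Gamma moment with the Laplace weight: `∫_{s>0} K·s^{α+θ}·(β^{α+1}e^{−βs}) ds = K·Γ(α+θ+1)·β^{−θ}` (`α + θ > −1`, `β > 0`). [folklore] -/
theorem integral_moment_weight {α θ K β : ℝ} (hαθ : -1 < α + θ) (hβ : 0 < β) :
    ∫ s in Ioi (0:ℝ), K * s ^ (α + θ) * (β ^ (α + 1) * Real.exp (-(β * s))) = K * Real.Gamma (α + θ + 1) * β ^ (-θ) := by
  have e : (fun s : ℝ => K * s ^ (α + θ) * (β ^ (α + 1) * Real.exp (-(β * s)))) = fun s => (K * β ^ (α + 1)) * (s ^ (α + θ) * Real.exp (-(β * s))) := by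
    funext s; ring
  rw [e, integral_const_mul, integral_rpow_mul_exp_neg_mul_Ioi' hαθ hβ, Real.rpow_neg hβ.le]
  have hb2 : β ^ (α + θ + 1) = β ^ (α + 1) * β ^ θ := by rw [← Real.rpow_add hβ]; ring_nf
  have hb1 : 0 < β ^ (α + 1) := Real.rpow_pos_of_pos hβ _
  have hb3 : 0 < β ^ θ := Real.rpow_pos_of_pos hβ _
  rw [hb2]; field_simp

/-- ★★ **TWO-TERM ABELIAN CORE**: for a finite measure `μ`, a measurable `G ≥ 0`, `α > 0`, `θ₁, θ₂ ≥ 0`, and the global bound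
`|μ{G ≤ s} − v·s^α| ≤ K₁·s^{α+θ₁} + K₂·s^{α+θ₂}` for all `s > 0`: for every `β > 0`,
`|β^α·∫e^{−βG}dμ − v·Γ(α+1)| ≤ K₁·Γ(α+θ₁+1)·β^{−θ₁} + K₂·Γ(α+θ₂+1)·β^{−θ₂}`. [folklore] -/
theorem laplace_abelian_two_terms (μ : Measure Ω) [IsFiniteMeasure μ] {G : Ω → ℝ} (hG : Measurable G) (hG0 : ∀ ω, 0 ≤ G ω)
    {α v K₁ θ₁ K₂ θ₂ : ℝ} (hα : 0 < α) (hθ₁ : 0 ≤ θ₁) (hθ₂ : 0 ≤ θ₂)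
    (hm : ∀ s : ℝ, 0 < s → |(μ {ω | G ω ≤ s}).toReal - v * s ^ α| ≤ K₁ * s ^ (α + θ₁) + K₂ * s ^ (α + θ₂)) {β : ℝ} (hβ : 0 < β) :
    |β ^ α * ∫ ω, Real.exp (-(β * G ω)) ∂μ - v * Real.Gamma (α + 1)| ≤
      K₁ * Real.Gamma (α + θ₁ + 1) * β ^ (-θ₁) + K₂ * Real.Gamma (α + θ₂ + 1) * β ^ (-θ₂) := by
  set M : ℝ := (μ univ).toReal with hM
  set m : ℝ → ℝ := fun s => (μ {ω | G ω ≤ s}).toReal with hm_def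
  have hm0 : ∀ s, 0 ≤ m s := fun s => ENNReal.toReal_nonneg
  have hmM : ∀ s, m s ≤ M := fun s => ENNReal.toReal_mono (measure_ne_top μ _) (measure_mono (subset_univ _))
  have hmeas : Measurable m := ENNReal.measurable_toReal.comp (measurable_measure_le μ G)
  have hI0 : IntegrableOn (fun s : ℝ => s ^ α * Real.exp (-(β * s))) (Ioi 0) := integrableOn_rpow_mul_exp_neg_mul (by linarith) hβ
  have hI1 : IntegrableOn (fun s : ℝ => s ^ (α + θ₁) * Real.exp (-(β * s))) (Ioi 0) := integrableOn_rpow_mul_exp_neg_mul (by linarith) hβ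
  have hI2 : IntegrableOn (fun s : ℝ => s ^ (α + θ₂) * Real.exp (-(β * s))) (Ioi 0) := integrableOn_rpow_mul_exp_neg_mul (by linarith) hβ
  -- the layer cake and the model term
  have hL : β ^ α * ∫ ω, Real.exp (-(β * G ω)) ∂μ = ∫ s in Ioi (0:ℝ), m s * (β ^ (α + 1) * Real.exp (-(β * s))) := by
    rw [integral_exp_neg_mul_eq_layerCake μ hG hG0 hβ, ← integral_const_mul]
    refine setIntegral_congr_fun measurableSet_Ioi fun s _ => ?_
    simp only [hm_def]
    rw [Real.rpow_add hβ, Real.rpow_one]; ring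
  have hV : v * Real.Gamma (α + 1) = ∫ s in Ioi (0:ℝ), v * s ^ α * (β ^ (α + 1) * Real.exp (-(β * s))) := by
    have h := integral_moment_weight (K := v) (α := α) (θ := 0) (by linarith) hβ
    simp only [add_zero, neg_zero, Real.rpow_zero, mul_one] at h
    exact h.symm
  -- integrability of the two pieces
  have hIm : IntegrableOn (fun s : ℝ => m s * (β ^ (α + 1) * Real.exp (-(β * s)))) (Ioi 0) := by
    have hb : IntegrableOn (fun s : ℝ => M * (β ^ (α + 1) * Real.exp (-(β * s)))) (Ioi 0) := by
      have h := ((exp_neg_integrableOn_Ioi 0 hβ).const_mul (β ^ (α + 1))).const_mul M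
      simp only [neg_mul] at h
      exact h
    refine hb.mono' ((hmeas.mul (by fun_prop)).aestronglyMeasurable) (ae_of_all _ fun s => ?_)
    rw [Real.norm_eq_abs, abs_of_nonneg (mul_nonneg (hm0 s) (by positivity))]
    exact mul_le_mul_of_nonneg_right (hmM s) (by positivity)
  have hIv : IntegrableOn (fun s : ℝ => v * s ^ α * (β ^ (α + 1) * Real.exp (-(β * s)))) (Ioi 0) := by
    have e : (fun s : ℝ => v * s ^ α * (β ^ (α + 1) * Real.exp (-(β * s)))) = fun s => (v * β ^ (α + 1)) * (s ^ α * Real.exp (-(β * s))) := by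
      funext s; ring
    rw [e]; exact hI0.const_mul (v * β ^ (α + 1))
  have hIφ : IntegrableOn (fun s : ℝ => K₁ * s ^ (α + θ₁) * (β ^ (α + 1) * Real.exp (-(β * s))) +
      K₂ * s ^ (α + θ₂) * (β ^ (α + 1) * Real.exp (-(β * s)))) (Ioi 0) := by
    have e1 : (fun s : ℝ => K₁ * s ^ (α + θ₁) * (β ^ (α + 1) * Real.exp (-(β * s)))) = fun s => (K₁ * β ^ (α + 1)) * (s ^ (α + θ₁) * Real.exp (-(β * s))) := by
      funext s; ring
    have e2 : (fun s : ℝ => K₂ * s ^ (α + θ₂) * (β ^ (α + 1) * Real.exp (-(β * s)))) = fun s => (K₂ * β ^ (α + 1)) * (s ^ (α + θ₂) * Real.exp (-(β * s))) := by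
      funext s; ring
    have h1 : IntegrableOn (fun s : ℝ => K₁ * s ^ (α + θ₁) * (β ^ (α + 1) * Real.exp (-(β * s)))) (Ioi 0) := by rw [e1]; exact hI1.const_mul _
    have h2 : IntegrableOn (fun s : ℝ => K₂ * s ^ (α + θ₂) * (β ^ (α + 1) * Real.exp (-(β * s)))) (Ioi 0) := by rw [e2]; exact hI2.const_mul _
    exact h1.add h2
  -- the difference as one integral
  rw [hL, hV, ← integral_sub hIm hIv]
  have hdom : ∀ s ∈ Ioi (0:ℝ), ‖m s * (β ^ (α + 1) * Real.exp (-(β * s))) - v * s ^ α * (β ^ (α + 1) * Real.exp (-(β * s)))‖ ≤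
      K₁ * s ^ (α + θ₁) * (β ^ (α + 1) * Real.exp (-(β * s))) + K₂ * s ^ (α + θ₂) * (β ^ (α + 1) * Real.exp (-(β * s))) := by
    intro s hs
    have hs0 : 0 < s := hs
    have hw : 0 ≤ β ^ (α + 1) * Real.exp (-(β * s)) := by positivity
    rw [Real.norm_eq_abs, show m s * (β ^ (α + 1) * Real.exp (-(β * s))) - v * s ^ α * (β ^ (α + 1) * Real.exp (-(β * s))) =
      (m s - v * s ^ α) * (β ^ (α + 1) * Real.exp (-(β * s))) by ring, abs_mul, abs_of_nonneg hw]
    calc |m s - v * s ^ α| * (β ^ (α + 1) * Real.exp (-(β * s)))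
        ≤ (K₁ * s ^ (α + θ₁) + K₂ * s ^ (α + θ₂)) * (β ^ (α + 1) * Real.exp (-(β * s))) := mul_le_mul_of_nonneg_right (hm s hs0) hw
      _ = _ := by ring
  have hbound := norm_integral_le_of_norm_le hIφ ((ae_restrict_iff' measurableSet_Ioi).2 (ae_of_all _ hdom))
  rw [Real.norm_eq_abs] at hbound
  refine hbound.trans (le_of_eq ?_)
  have h1 : IntegrableOn (fun s : ℝ => K₁ * s ^ (α + θ₁) * (β ^ (α + 1) * Real.exp (-(β * s)))) (Ioi 0) := by
    have e1 : (fun s : ℝ => K₁ * s ^ (α + θ₁) * (β ^ (α + 1) * Real.exp (-(β * s)))) = fun s => (K₁ * β ^ (α + 1)) * (s ^ (α + θ₁) * Real.exp (-(β * s))) := by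
      funext s; ring
    rw [e1]; exact hI1.const_mul _
  have h2 : IntegrableOn (fun s : ℝ => K₂ * s ^ (α + θ₂) * (β ^ (α + 1) * Real.exp (-(β * s)))) (Ioi 0) := by
    have e2 : (fun s : ℝ => K₂ * s ^ (α + θ₂) * (β ^ (α + 1) * Real.exp (-(β * s)))) = fun s => (K₂ * β ^ (α + 1)) * (s ^ (α + θ₂) * Real.exp (-(β * s))) := by
      funext s; ring
    rw [e2]; exact hI2.const_mul _
  rw [integral_add h1 h2, integral_moment_weight (by linarith) hβ, integral_moment_weight (by linarith) hβ]

/-! ## §5 The limit form -/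

/-- ★★★ **ABELIAN THEOREM, LIMIT FORM**: for a finite measure `μ`, a measurable `G ≥ 0`, `α > 0`, and the small-ball LIMIT
`μ{G ≤ s}/s^α → v` as `s → 0⁺`: `β^α·∫e^{−βG}dμ → v·Γ(α+1)` as `β → ∞`. [folklore] -/
theorem tendsto_laplace_abelian (μ : Measure Ω) [IsFiniteMeasure μ] {G : Ω → ℝ} (hG : Measurable G) (hG0 : ∀ ω, 0 ≤ G ω)
    {α v : ℝ} (hα : 0 < α) (hlim : Tendsto (fun s : ℝ => (μ {ω | G ω ≤ s}).toReal / s ^ α) (𝓝[>] 0) (𝓝 v)) :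
    Tendsto (fun β : ℝ => β ^ α * ∫ ω, Real.exp (-(β * G ω)) ∂μ) atTop (𝓝 (v * Real.Gamma (α + 1))) := by
  set M : ℝ := (μ univ).toReal with hM
  have hM0 : 0 ≤ M := ENNReal.toReal_nonneg
  have hm0 : ∀ s, 0 ≤ (μ {ω | G ω ≤ s}).toReal := fun s => ENNReal.toReal_nonneg
  have hmM : ∀ s, (μ {ω | G ω ≤ s}).toReal ≤ M := fun s => ENNReal.toReal_mono (measure_ne_top μ _) (measure_mono (subset_univ _))
  -- `v ≥ 0`
  have hv : 0 ≤ v := by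
    refine ge_of_tendsto hlim ?_
    filter_upwards [self_mem_nhdsWithin] with s hs
    exact div_nonneg (hm0 s) (Real.rpow_nonneg (le_of_lt hs) _)
  have hΓ : 0 < Real.Gamma (α + 1) := Real.Gamma_pos_of_pos (by linarith)
  have hΓ2 : 0 < Real.Gamma (α + 1 + 1) := Real.Gamma_pos_of_pos (by linarith)
  rw [Metric.tendsto_atTop]
  intro ε hε
  -- choose `δ ∈ (0,1]` with `|m(s)/s^α − v| ≤ η` on `(0, δ]`, `η = ε/(2Γ(α+1))`
  set η : ℝ := ε / (2 * Real.Gamma (α + 1)) with hη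
  have hη0 : 0 < η := by positivity
  have hev : ∀ᶠ s in 𝓝[>] (0:ℝ), |(μ {ω | G ω ≤ s}).toReal / s ^ α - v| < η := by
    have := (Metric.tendsto_nhds.1 hlim) η hη0
    simpa only [Real.dist_eq] using this
  obtain ⟨δ₀, hδ₀, hδ₀'⟩ : ∃ δ₀ > 0, ∀ s, 0 < s → s < δ₀ → |(μ {ω | G ω ≤ s}).toReal / s ^ α - v| < η := by
    rw [Filter.Eventually, mem_nhdsGT_iff_exists_Ioo_subset] at hev
    obtain ⟨u, hu, hsub⟩ := hev
    exact ⟨u, hu, fun s hs hsu => hsub ⟨hs, hsu⟩⟩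
  set δ : ℝ := min (δ₀ / 2) 1 with hδ
  have hδ0 : 0 < δ := by positivity
  have hδ1 : δ ≤ 1 := min_le_right _ _
  have hδδ₀ : δ < δ₀ := by have := min_le_left (δ₀ / 2) 1; linarith
  -- the global two-term bound: `η s^α + C s^{α+1}`, `C = (M + v)·δ^{−(α+1)}`
  set C : ℝ := (M + v) * δ ^ (-(α + 1)) with hC
  have hC0 : 0 ≤ C := by positivity
  have hm : ∀ s : ℝ, 0 < s → |(μ {ω | G ω ≤ s}).toReal - v * s ^ α| ≤ η * s ^ (α + 0) + C * s ^ (α + 1) := by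
    intro s hs
    rw [add_zero]
    have hsα : 0 < s ^ α := Real.rpow_pos_of_pos hs _
    rcases le_or_gt s δ with h | h
    · have h1 := hδ₀' s hs (lt_of_le_of_lt h hδδ₀)
      have h2 : |(μ {ω | G ω ≤ s}).toReal - v * s ^ α| ≤ η * s ^ α := by
        have e : (μ {ω | G ω ≤ s}).toReal - v * s ^ α = ((μ {ω | G ω ≤ s}).toReal / s ^ α - v) * s ^ α := by field_simp
        rw [e, abs_mul, abs_of_pos hsα]
        exact mul_le_mul_of_nonneg_right h1.le hsα.le
      linarith [mul_nonneg hC0 (Real.rpow_nonneg hs.le (α + 1))]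
    · -- far part: `m + v s^α ≤ (M + v)·(s/δ)^{α+1}`… via `1 ≤ (s/δ)`, written with `δ^{−(α+1)} s^{α+1}`
      have hδp : 0 < δ ^ (α + 1) := Real.rpow_pos_of_pos hδ0 _
      have hq : 1 ≤ δ ^ (-(α + 1)) * s := by
        -- `δ^{−(α+1)}·s ≥ δ^{−(α+1)}·δ = δ^{−α} ≥ 1`
        have h1 : δ ^ (-(α + 1)) * δ ≤ δ ^ (-(α + 1)) * s := mul_le_mul_of_nonneg_left h.le (Real.rpow_nonneg hδ0.le _)
        have h2 : 1 ≤ δ ^ (-(α + 1)) * δ := by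
          rw [Real.rpow_neg hδ0.le, Real.rpow_add hδ0, Real.rpow_one, mul_inv, mul_assoc, inv_mul_cancel₀ hδ0.ne', mul_one]
          exact one_le_inv_iff₀.2 ⟨Real.rpow_pos_of_pos hδ0 _, Real.rpow_le_one hδ0.le hδ1 hα.le⟩
        exact h2.trans h1
      have hsplit : δ ^ (-(α + 1)) * s ^ (α + 1) = (δ ^ (-(α + 1)) * s) * s ^ α := by
        rw [Real.rpow_add hs, Real.rpow_one]; ring
      have hpow : s ^ α ≤ δ ^ (-(α + 1)) * s ^ (α + 1) := by
        rw [hsplit]; exact le_mul_of_one_le_left hsα.le hq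
      have hone : (1:ℝ) ≤ δ ^ (-(α + 1)) * s ^ (α + 1) := by
        have h1 : δ ^ (α + 1) ≤ s ^ (α + 1) := Real.rpow_le_rpow hδ0.le h.le (by linarith)
        have h2 : δ ^ (-(α + 1)) * δ ^ (α + 1) = 1 := by rw [Real.rpow_neg hδ0.le, inv_mul_cancel₀ hδp.ne']
        calc (1:ℝ) = δ ^ (-(α + 1)) * δ ^ (α + 1) := h2.symm
          _ ≤ δ ^ (-(α + 1)) * s ^ (α + 1) := mul_le_mul_of_nonneg_left h1 (Real.rpow_nonneg hδ0.le _)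
      calc |(μ {ω | G ω ≤ s}).toReal - v * s ^ α| ≤ |(μ {ω | G ω ≤ s}).toReal| + |v * s ^ α| := abs_sub _ _
        _ = (μ {ω | G ω ≤ s}).toReal + v * s ^ α := by rw [abs_of_nonneg (hm0 s), abs_of_nonneg (by positivity)]
        _ ≤ M * (δ ^ (-(α + 1)) * s ^ (α + 1)) + v * (δ ^ (-(α + 1)) * s ^ (α + 1)) :=
            add_le_add (by nlinarith [hmM s, hm0 s]) (mul_le_mul_of_nonneg_left hpow hv)
        _ = C * s ^ (α + 1) := by rw [hC]; ring
        _ ≤ η * s ^ α + C * s ^ (α + 1) := by nlinarith [hη0.le, hsα.le]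
  -- apply the core and choose `β` large
  refine ⟨max 1 (2 * C * Real.Gamma (α + 1 + 1) / ε + 1), fun β hβ => ?_⟩
  have hβ1 : 1 ≤ β := le_trans (le_max_left _ _) hβ
  have hβ0 : 0 < β := by linarith
  have hcore := laplace_abelian_two_terms μ hG hG0 hα le_rfl zero_le_one hm hβ0
  rw [Real.dist_eq]
  refine lt_of_le_of_lt hcore ?_
  rw [neg_zero, Real.rpow_zero, mul_one, add_zero]
  -- first term `= ε/2`
  have h1 : η * Real.Gamma (α + 1) = ε / 2 := by rw [hη]; field_simp
  -- second term `< ε/2`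
  have hβlarge : 2 * C * Real.Gamma (α + 1 + 1) / ε + 1 ≤ β := le_trans (le_max_right _ _) hβ
  have h2 : C * Real.Gamma (α + 1 + 1) * β ^ (-(1:ℝ)) < ε / 2 := by
    rw [Real.rpow_neg_one, show C * Real.Gamma (α + 1 + 1) * β⁻¹ = (C * Real.Gamma (α + 1 + 1)) / β from rfl, div_lt_iff₀ hβ0]
    have hx : 2 * C * Real.Gamma (α + 1 + 1) / ε < β := by linarith
    have hx2 : 2 * C * Real.Gamma (α + 1 + 1) < β * ε := (div_lt_iff₀ hε).1 hx
    linarith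
  linarith

/-! ## §6 Instantiation: the σ-twisted four-leader block in Laplace form (limit) -/

open Quaternion Literature.MathematicalPhysics.QuantumLattice
open scoped Quaternion
open Literature.MathematicalPhysics.QuantumFieldTheory (haarProbability)
open Literature.MathematicalPhysics.QuantumFieldTheory.Balaban1983to89.T4HaarSU2Translate (continuous_su2Quat)
open Summit.QuantumFields.YangMills.Theorems.SwapVirialDeficit.ZeroModeSigma (sigmaBall sigmaBall_smallBall_limit)

/-- The max of the six (here: `9 + 3`, with the trivial diagonal and symmetric repetitions) relation norms of `ℤ³ ⋊_σ ℤ` up to `t`. [folklore] -/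
def sigmaMax (C : Fin 4 → Matrix.specialUnitaryGroup (Fin 2) ℂ) : ℝ :=
  max (⨆ p : Fin 3 × Fin 3, ‖su2Quat (C p.1.castSucc) * su2Quat (C p.2.castSucc) - su2Quat (C p.2.castSucc) * su2Quat (C p.1.castSucc)‖)
    (⨆ μ : Fin 3, ‖su2Quat (C (Fin.last 3)) * su2Quat (C (Equiv.swap (0 : Fin 3) 1 μ).castSucc) - su2Quat (C μ.castSucc) * su2Quat (C (Fin.last 3))‖)

/-- The squared max relation `G_σ = sigmaMax²`. [folklore] -/
def sigmaMaxSq (C : Fin 4 → Matrix.specialUnitaryGroup (Fin 2) ℂ) : ℝ := sigmaMax C ^ 2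

/-- `sigmaMax ≥ 0`. [folklore] -/
theorem sigmaMax_nonneg (C : Fin 4 → Matrix.specialUnitaryGroup (Fin 2) ℂ) : 0 ≤ sigmaMax C :=
  le_max_of_le_left (Real.iSup_nonneg fun _ => norm_nonneg _)

/-- `sigmaMax` is measurable. [folklore] -/
theorem measurable_sigmaMax : Measurable sigmaMax := by
  have hq : ∀ i : Fin 4, Continuous fun C : Fin 4 → Matrix.specialUnitaryGroup (Fin 2) ℂ => su2Quat (C i) :=
    fun i => continuous_su2Quat.comp (continuous_apply i)
  unfold sigmaMax
  refine Measurable.max (Measurable.iSup fun p => ?_) (Measurable.iSup fun μ => ?_)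
  · exact (((hq _).mul (hq _)).sub ((hq _).mul (hq _))).norm.measurable
  · exact (((hq _).mul (hq _)).sub ((hq _).mul (hq _))).norm.measurable

/-- `G_σ` is measurable and nonnegative. [folklore] -/
theorem measurable_sigmaMaxSq : Measurable sigmaMaxSq := measurable_sigmaMax.pow_const 2

/-- `{G_σ ≤ s} = E_σ(√s)` for `s ≥ 0`. [folklore] -/
theorem setOf_sigmaMaxSq_le {s : ℝ} (hs : 0 ≤ s) : {C | sigmaMaxSq C ≤ s} = sigmaBall (Real.sqrt s) := by
  ext C
  simp only [mem_setOf_eq, sigmaMaxSq, sigmaBall]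
  rw [← Real.le_sqrt (sigmaMax_nonneg C) hs, sigmaMax, max_le_iff, ciSup_le_iff (Finite.bddAbove_range _),
    ciSup_le_iff (Finite.bddAbove_range _)]
  constructor
  · rintro ⟨h1, h2⟩; exact ⟨fun μ ν => h1 (μ, ν), h2⟩
  · rintro ⟨h1, h2⟩; exact ⟨fun p => h1 p.1 p.2, h2⟩

/-- ★★★ **THE σ-TWISTED FOUR-LEADER BLOCK IN LAPLACE FORM** (Abelian image of w3 g63's ✓`sigmaBall_smallBall_limit`):
`∃ v > 0, β^{7/2}·∫_{SU(2)⁴} e^{−β·G_σ} dHaar⁴ → v·Γ(7/2 + 1)` as `β → ∞`, `G_σ = (max of the relation norms)²`, with `v` THE small-ball constant `v₇`.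
HONEST LABEL: plan-level zero-mode rung; NOT ⟨24197⟩; the Yang–Mills mass gap is NOT proved. [cite: Luscher1983, §2] [cite: Vanbaal2001] -/
theorem tendsto_laplace_sigmaTwisted :
    ∃ v : ℝ, 0 < v ∧
      Tendsto (fun t : ℝ => ((Measure.pi fun _ : Fin 4 => haarProbability (Matrix.specialUnitaryGroup (Fin 2) ℂ)) (sigmaBall t)).toReal / t ^ 7)
        (𝓝[>] (0:ℝ)) (𝓝 v) ∧
      Tendsto (fun β : ℝ => β ^ ((7:ℝ) / 2) * ∫ C, Real.exp (-(β * sigmaMaxSq C))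
        ∂(Measure.pi fun _ : Fin 4 => haarProbability (Matrix.specialUnitaryGroup (Fin 2) ℂ))) atTop (𝓝 (v * Real.Gamma ((7:ℝ) / 2 + 1))) := by
  obtain ⟨v, hv, hT⟩ := sigmaBall_smallBall_limit
  refine ⟨v, hv, hT, ?_⟩
  set μ4 := Measure.pi fun _ : Fin 4 => haarProbability (Matrix.specialUnitaryGroup (Fin 2) ℂ) with hμ4
  -- the small-ball limit in the variable `s = t²`
  have hsqrt : Tendsto (fun s : ℝ => Real.sqrt s) (𝓝[>] (0:ℝ)) (𝓝[>] (0:ℝ)) := by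
    refine tendsto_nhdsWithin_iff.2 ⟨?_, ?_⟩
    · have h := (Real.continuous_sqrt.tendsto (0:ℝ)).mono_left (nhdsWithin_le_nhds (s := Ioi (0:ℝ)))
      rwa [Real.sqrt_zero] at h
    · filter_upwards [self_mem_nhdsWithin] with s hs using Real.sqrt_pos.2 hs
  have hlim : Tendsto (fun s : ℝ => (μ4 {C | sigmaMaxSq C ≤ s}).toReal / s ^ ((7:ℝ) / 2)) (𝓝[>] (0:ℝ)) (𝓝 v) := by
    refine (hT.comp hsqrt).congr' ?_
    filter_upwards [self_mem_nhdsWithin] with s hs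
    simp only [Function.comp_apply]
    rw [setOf_sigmaMaxSq_le (le_of_lt hs)]
    congr 1
    rw [Real.sqrt_eq_rpow, ← Real.rpow_natCast, ← Real.rpow_mul (le_of_lt hs)]
    norm_num
  exact tendsto_laplace_abelian μ4 measurable_sigmaMaxSq (fun C => sq_nonneg _) (by norm_num) hlim

end Summit.QuantumFields.YangMills.Theorems.SwapVirialDeficit.Abelian

end
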